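import Mathlib.NumberTheory.RatFunc.Ostrowski
import Mathlib.FieldTheory.RatFunc.Valuation
import Mathlib.RingTheory.DedekindDomain.AdicValuation
import Mathlib.RingTheory.Valuation.Discrete.Basic
import Mathlib.RingTheory.Localization.AtPrime.Basic
import Literature.NumberTheory.DiophantineGeometry.FunctionFieldGenusRatPlacesProofs
import Literature.NumberTheory.DiophantineGeometry.FunctionFieldDivisorsResidueMap
import HarnessLib

/-!
# The places of the rational function field `K(X)/K` (Stichtenoth §1.2)

For an arbitrary field `K`, this file determines the places of the rational function field
`K(X)/K` in the sense of `Literature.NumberTheory.DiophantineGeometry.FunctionFieldDivisors`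
(`Literature.AlgFunctionField.PlaceOver K (RatFunc K)`: valuation rings `K ⊆ O ⊊ K(X)` that are
discrete valuation rings), together with their prime elements and degrees, following
H. Stichtenoth,
*Algebraic Function Fields and Codes*, 2nd ed., GTM 254 (2009), §1.2 "The Rational Function
Field" (Prop. 1.2.1 and Thm. 1.2.2; read in the held copy
`book:stichtenothnd-algebraic-function-fields-codes`, pdf pp. 19–21). It is the first half of the
computation of the genus of `K(X)` (Stichtenoth Example 1.4.18, the named fact
`Literature.NumberTheory.DiophantineGeometry.AlgFunctionField.genus_ratFunc` of `FunctionFieldGenus`), completed in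
`FunctionFieldGenusRatFuncProofs`.

## Main definitions

* `Literature.AlgFunctionField.ratFuncInftyPlace K`: the infinite place `P_∞` of `K(X)/K` (Stichtenoth
  (1.10)–(1.11)); its valuation ring `O_∞ = {f/g | deg f ≤ deg g}` is the valuation ring of
  Mathlib's `RatFunc.inftyValuation K`.
* `Literature.AlgFunctionField.ratFuncPlaceEquiv K :
    Option (HeightOneSpectrum K[X]) ≃ PlaceOver K (RatFunc K)` (`none ↦ P_∞`,
  `some q ↦ P_q`): the list of all places of `K(X)/K` without repetition.

The finite places `P_{p(x)}` (Stichtenoth (1.7)–(1.8)) are not redefined: they are the places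
`Literature.AlgFunctionField.PlaceOver.ofPrime K (RatFunc K) q` of
`Literature.NumberTheory.DiophantineGeometry.FunctionFieldGenusRatPlacesProofs`, `q = (p(x))` a
nonzero prime of `K[X]`, whose valuation ring `{z | v_q(z) ≤ 1}` is the localisation
`O_{p(x)} = K[X]_{(p)} ⊆ K(X)` (Mathlib
`IsDedekindDomain.HeightOneSpectrum.valuationSubringAtPrime_eq_valuationSubring`).

## Main statements

* `eq_inftyValuationSubring_or_exists_eq_adicValuationSubring`: **Theorem 1.2.2** — a
  valuation ring `O` of `K(X)` with `K ⊆ O ≠ K(X)` is `O_∞` or some `O_{p(x)}`; the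
  `PlaceOver` form is `eq_ratFuncInftyPlace_or_exists_eq_ofPrime`, packaged as the bijection
  `ratFuncPlaceEquiv` (injectivity: distinct primes give inequivalent valuations,
  `PlaceOver.ofPrime_injective`, and `P_p ≠ P_∞`, Mathlib
  `RatFunc.adicValuation_not_isEquiv_infty_valuation`).
* `PlaceOver.valuation_ofPrime_le_iff`, `valuation_ratFuncInftyPlace_le_iff`:
  **Prop. 1.2.1 (a), (c)**, prime elements — `p(x)` is a prime element of `P_{p(x)}` and `1/x`
  one of `P_∞`; stated in the form consumed by Riemann–Roch spaces: the condition
  `v_P(z) ≤ v_P(π_P) ^ (-n)` of `riemannRochSpace` (for the *chosen* uniformizer `π_P` of the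
  place) is `v_p(z) ≤ exp n` for Mathlib's `p`-adic valuation, resp. `v_∞(z) ≤ exp n`
  (via `PlaceOver.valuation_le_iff_of_isEquiv` of `FunctionFieldDivisorsResidueMap`).
* `degree_ofPrime_eq_finrank_quotient`, `degree_ofPrime_eq_natDegree`,
  `degree_ratFuncInftyPlace`: **Prop. 1.2.1 (a), (c)**, residue fields —
  `deg P_{p(x)} = [K[X]/(p(x)) : K] = deg p(x)` and `deg P_∞ = 1`.

## Proofs

Thm. 1.2.2 is proved as in the book. Case 1, `x ∈ O`: then `K[X] ⊆ O`, `I := K[X] ∩ 𝔪_O` is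
a prime ideal, nonzero because otherwise every nonzero polynomial — hence every element of
`K(X)` — would be a unit of `O`, contradicting `O ≠ K(X)` (the book invokes Prop. 1.1.15 here;
this direct argument avoids it); every `g ∉ I` is a unit of `O`, so `O_{p(x)} = K[X]_I ⊆ O`,
and valuation rings of Krull dimension `≤ 1` are maximal proper subrings (book: Thm. 1.1.13;
Mathlib `ValuationSubring.eq_of_le_of_ne_top`). Case 2, `x ∉ O`, i.e. `v(x) > 1`: the book
computes `O ⊇ O_∞` by hand; we use Mathlib's form of the same computation,
`RatFunc.valuation_isEquiv_inftyValuation_of_one_lt_valuation_X` (Ostrowski for `K(X)`).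
Prop. 1.2.1: the residue field of `O_{p(x)}` is computed exactly as in the book
(`φ : K[X] → O/𝔪`, kernel `(p)`, surjective because `a p + b v = 1` gives `u/v ≡ b u`); for
`P_∞` every `f/g` with `deg f ≤ deg g` is congruent to the constant `z(∞)` (ratio of leading
coefficients or `0`). Prime elements: the chosen uniformizer of a place whose valuation is
equivalent to a `ℤᵐ⁰`-valued valuation `v` attaining `exp (-1)` has `v`-valuation `exp (-1)`
(`PlaceOver.map_uniformizer_eq_of_isEquiv`, `PlaceOver.valuation_le_iff_of_isEquiv` in
`FunctionFieldDivisorsResidueMap`), which transports statements about the chosen uniformizer of a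
`PlaceOver` to Mathlib's normalised valuations.

## Mathlib

Searched (`lean search`): Mathlib has the two model valuations (`HeightOneSpectrum.valuation`,
`RatFunc.inftyValuation`), Ostrowski's theorem for `K(X)` (`Mathlib.NumberTheory.RatFunc.Ostrowski`:
every nontrivial valuation trivial on `K` is *equivalent* to one of them) and
`valuationSubringAtPrime`, but no notion of place of `F/K`, no degree of a place and no statement
about residue fields of these valuation rings; nothing below duplicates a Mathlib declaration.
The sibling G16 file `Literature.NumberTheory.EllipticCurves.FunctionFieldPlaceDegreesProofs`
treats valuation rings of finite extensions of `𝔽_q(X)` (finite constant field, namespace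
`Literature.FunctionField`) and is not applicable to a general `K`.

## References

* H. Stichtenoth, *Algebraic Function Fields and Codes*, 2nd ed., GTM 254, Springer 2009, §1.2,
  (1.7)–(1.11), Prop. 1.2.1, Thm. 1.2.2. doi:10.1007/978-3-540-76878-4
-/

noncomputable section

namespace Literature.NumberTheory.DiophantineGeometry.AlgFunctionField

universe u v

/-! ### Places cut out by a valuation: integers, maximal ideal, `L(D)` at `P_𝔭` -/

namespace PlaceOver

open WithZero

variable {K : Type u} {F : Type v} [Field K] [Field F] [Algebra K F]

/-- If the valuation ring of the place `w` is `{x | v x ≤ 1}` for a valuation `v` of `F`, then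
`O_w` is a ring of integers of `v` in Mathlib's sense (`Valuation.Integers`). [folklore] -/
theorem integers_of_mem_iff (w : PlaceOver K F) {Γ : Type*} [LinearOrderedCommGroupWithZero Γ]
    {v : Valuation F Γ} (hO : ∀ x, x ∈ w.toValuationSubring ↔ v x ≤ 1) :
    v.Integers w.toValuationSubring where
  hom_inj := Subtype.val_injective
  map_le_one x := (hO x).1 x.2
  exists_of_le_one r hr := ⟨⟨r, (hO r).2 hr⟩, rfl⟩

/-- If the valuation ring of the place `w` is `{x | v x ≤ 1}`, then the maximal ideal of `O_w` is
`{x | v x < 1}`. [folklore] -/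
theorem mem_maximalIdeal_iff_of_mem_iff (w : PlaceOver K F) {Γ : Type*}
    [LinearOrderedCommGroupWithZero Γ] {v : Valuation F Γ}
    (hO : ∀ x, x ∈ w.toValuationSubring ↔ v x ≤ 1) (x : w.toValuationSubring) :
    x ∈ IsLocalRing.maximalIdeal w.toValuationSubring ↔ v x < 1 := by
  rw [IsLocalRing.mem_maximalIdeal, mem_nonunits_iff,
    (w.integers_of_mem_iff hO).isUnit_iff_valuation_eq_one]
  change v x ≠ 1 ↔ v x < 1
  exact ⟨fun h ↦ lt_of_le_of_ne ((hO x).1 x.2) h, fun h ↦ h.ne⟩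

/-- **Reading `L(D)` at a place `P_𝔭 = PlaceOver.ofPrime K F 𝔭`.** The chosen uniformizer of
`P_𝔭` has `𝔭`-adic valuation `exp (-1)` (any generator of `𝔭 R_𝔭` is a prime element), so the
condition `v_P(z) ≤ v_P(π_P) ^ (-n)` defining the Riemann–Roch space reads `v_𝔭(z) ≤ exp n` for
Mathlib's normalised `𝔭`-adic valuation. For `K(x)` this is Stichtenoth Prop. 1.2.1 (a): `p(x)`
is a prime element of `P_{p(x)}` and `v_P(p^n f/g) = n`. [cite: Stichtenoth2009, Prop. 1.2.1(a)] -/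
theorem valuation_ofPrime_le_iff {R : Type*} [CommRing R] [IsDedekindDomain R] [Algebra R F]
    [IsFractionRing R F] [Algebra K R] [IsScalarTower K R F]
    (𝔭 : IsDedekindDomain.HeightOneSpectrum R) (z : F) (n : ℤ) :
    (PlaceOver.ofPrime K F 𝔭).valuation z ≤
        (PlaceOver.ofPrime K F 𝔭).valuation ((PlaceOver.ofPrime K F 𝔭).uniformizer : F) ^ (-n) ↔
      𝔭.valuation F z ≤ exp n :=
  (PlaceOver.ofPrime K F 𝔭).valuation_le_iff_of_isEquiv
    (Valuation.isEquiv_valuation_valuationSubring _) (𝔭.valuation_exists_uniformizer F) z n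

end PlaceOver

/-! ### The places of the rational function field `K(X)/K` (Stichtenoth §1.2) -/

section RatFunc

open IsDedekindDomain Polynomial WithZero

variable (K : Type u) [Field K]

/- The finite places `P_{p(x)}` of `K(X)/K` (Stichtenoth (1.7)–(1.8)) are the places
`PlaceOver.ofPrime K (RatFunc K) q`, `q = (p(x))` a nonzero prime of `K[X]`, of
`Literature.NumberTheory.DiophantineGeometry.FunctionFieldGenusRatPlacesProofs` (valuation ring
`{z | v_q(z) ≤ 1} = K[X]_{(p)}`, Mathlib
`HeightOneSpectrum.valuationSubringAtPrime_eq_valuationSubring`); they are not redefined here. -/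

/-- The **infinite place** `P_∞` of `K(X)/K` (Stichtenoth §1.2, (1.10)–(1.11)): its valuation
ring is `O_∞ = {f/g | deg f ≤ deg g}`, the valuation ring of Mathlib's `RatFunc.inftyValuation`
(`v_∞(f/g) = deg g - deg f`), a discrete valuation ring containing `K`.
[cite: Stichtenoth2009, §1.2 (1.10)-(1.11) and Prop. 1.2.1(c)] -/
def ratFuncInftyPlace : PlaceOver K (RatFunc K) :=
  -- Mathlib's `RatFunc.inftyValuation` takes a `DecidableEq (RatFunc K)` argument (only used to
  -- decide `x = 0`); the place is defined with the classical instance and compared with an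
  -- arbitrary one in `ratFuncInftyPlace_toValuationSubring`.
  letI := Classical.decEq (RatFunc K)
  { toValuationSubring := (RatFunc.inftyValuation K).valuationSubring
    ne_top := by
      rw [Ne, Valuation.valuationSubring_eq_top_iff, not_not]
      infer_instance
    isDVR := inferInstance
    algebraMap_mem := fun c ↦ (Valuation.mem_valuationSubring_iff _ _).2
      (Valuation.IsTrivialOn.valuation_algebraMap_le_one _ c) }

variable {K}

/-- The valuation ring of `P_∞` is `{x | v_∞(x) ≤ 1}`, for any `DecidableEq (RatFunc K)`
instance feeding Mathlib's `RatFunc.inftyValuation` (they form a subsingleton). [folklore] -/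
@[simp]
theorem ratFuncInftyPlace_toValuationSubring [DecidableEq (RatFunc K)] :
    (ratFuncInftyPlace K).toValuationSubring = (RatFunc.inftyValuation K).valuationSubring := by
  obtain rfl : ‹DecidableEq (RatFunc K)› = Classical.decEq _ := Subsingleton.elim _ _
  rfl

/-- `O_{P_∞} = {x | v_∞(x) ≤ 1}`. [folklore] -/
theorem mem_ratFuncInftyPlace_iff [DecidableEq (RatFunc K)] (x : RatFunc K) :
    x ∈ (ratFuncInftyPlace K).toValuationSubring ↔ RatFunc.inftyValuation K x ≤ 1 := by
  rw [ratFuncInftyPlace_toValuationSubring, Valuation.mem_valuationSubring_iff]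

/-- The valuation of the place `P_∞` is equivalent to Mathlib's `RatFunc.inftyValuation`.
[folklore] -/
theorem isEquiv_valuation_ratFuncInftyPlace_inftyValuation [DecidableEq (RatFunc K)] :
    (ratFuncInftyPlace K).valuation.IsEquiv (RatFunc.inftyValuation K) := by
  rw [Valuation.isEquiv_iff_valuationSubring, PlaceOver.valuation,
    ValuationSubring.valuationSubring_valuation, ratFuncInftyPlace_toValuationSubring]

/-- `P_{p(x)} ≠ P_∞` (Mathlib `RatFunc.adicValuation_not_isEquiv_infty_valuation`). [folklore] -/
theorem ofPrime_ne_ratFuncInftyPlace (q : HeightOneSpectrum K[X]) :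
    PlaceOver.ofPrime K (RatFunc K) q ≠ ratFuncInftyPlace K := by
  classical
  intro h
  have h' : (q.valuation (RatFunc K)).valuationSubring =
      (RatFunc.inftyValuation K).valuationSubring := by
    rw [← ratFuncInftyPlace_toValuationSubring (K := K), ← h]; rfl
  rw [← Valuation.isEquiv_iff_valuationSubring] at h'
  exact RatFunc.adicValuation_not_isEquiv_infty_valuation q h'

/-- **Stichtenoth Theorem 1.2.2.** There are no places of the rational function field `K(X)/K`
other than the places `P_{p(x)}` (`(p(x)) ⊂ K[X]` a nonzero prime) and `P_∞`: every valuation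
ring `O` of `K(X)` with `K ⊆ O ≠ K(X)` is `O_∞` or some `O_{p(x)}`. Proof as in Stichtenoth:
if `X ∈ O` then `K[X] ⊆ O`, `I := K[X] ∩ 𝔪_O` is a nonzero prime, `K[X]_I ⊆ O` and valuation
rings of Krull dimension one are maximal proper subrings (Mathlib
`ValuationSubring.eq_of_le_of_ne_top`); if `X ∉ O` then the valuation of `O` is equivalent to
`v_∞` (Mathlib `RatFunc.valuation_isEquiv_inftyValuation_of_one_lt_valuation_X`).
[cite: Stichtenoth2009, Thm. 1.2.2] -/
theorem eq_inftyValuationSubring_or_exists_eq_adicValuationSubring [DecidableEq (RatFunc K)]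
    (O : ValuationSubring (RatFunc K)) (hO : O ≠ ⊤)
    (hK : ∀ c : K, algebraMap K (RatFunc K) c ∈ O) :
    O = (RatFunc.inftyValuation K).valuationSubring ∨
      ∃ q : HeightOneSpectrum K[X], O = (q.valuation (RatFunc K)).valuationSubring := by
  set v := O.valuation with hvdef
  haveI htriv : v.IsTrivialOn K := ⟨fun c hc ↦ by
    have hu : IsUnit (⟨algebraMap K (RatFunc K) c, hK c⟩ : O) :=
      IsUnit.of_mul_eq_one ⟨algebraMap K (RatFunc K) c⁻¹, hK c⁻¹⟩
        (Subtype.ext (by simp [hc]))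
    exact O.valuation_unit hu.unit⟩
  haveI hnt : v.IsNontrivial := by
    by_contra h
    apply hO
    rwa [← Valuation.valuationSubring_eq_top_iff, hvdef,
      ValuationSubring.valuationSubring_valuation] at h
  rcases lt_or_ge 1 (v RatFunc.X) with hlt | hle
  · -- Case 2 of Stichtenoth: the infinite place
    left
    have hequiv := RatFunc.valuation_isEquiv_inftyValuation_of_one_lt_valuation_X hlt
    rwa [Valuation.isEquiv_iff_valuationSubring, hvdef,
      ValuationSubring.valuationSubring_valuation] at hequiv
  · -- Case 1 of Stichtenoth: `K[X] ⊆ O`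
    right
    have hpoly : ∀ p : K[X], algebraMap K[X] (RatFunc K) p ∈ O := fun p ↦
      (O.valuation_le_one_iff _).1 (Polynomial.valuation_le_one_of_valuation_X_le_one _ hle p)
    let φ : K[X] →+* O := (algebraMap K[X] (RatFunc K)).codRestrict O hpoly
    let P : Ideal K[X] := (IsLocalRing.maximalIdeal O).comap φ
    have hPmem : ∀ p : K[X], p ∈ P ↔ v (algebraMap K[X] (RatFunc K) p) < 1 := fun p ↦ by
      rw [Ideal.mem_comap, ValuationSubring.valuation_lt_one_iff]; rfl
    haveI hPprime : P.IsPrime := Ideal.comap_isPrime φ _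
    -- polynomials outside `P` are units of `O`
    have hval1 : ∀ p : K[X], p ∉ P → v (algebraMap K[X] (RatFunc K) p) = 1 := fun p hp ↦
      le_antisymm (Polynomial.valuation_le_one_of_valuation_X_le_one _ hle p)
        (not_lt.1 ((hPmem p).not.1 hp))
    have hPne : P ≠ ⊥ := by
      intro hbot
      apply hO
      rw [eq_top_iff]
      intro f _
      rw [← O.valuation_le_one_iff]
      induction f using RatFunc.induction_on with
      | f p q hq =>
        by_cases hp : p = 0
        · simp [hp]
        · change v _ ≤ 1
          rw [map_div₀, hval1 p (by rw [hbot]; simpa using hp),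
            hval1 q (by rw [hbot]; simpa using hq), div_one]
    refine ⟨⟨P, hPprime, hPne⟩, ?_⟩
    rw [← HeightOneSpectrum.valuationSubringAtPrime_eq_valuationSubring]
    symm
    refine ValuationSubring.eq_of_le_of_ne_top _ ?_ hO
    rintro x ⟨a, s, hs, rfl⟩
    rw [← O.valuation_le_one_iff]
    change v _ ≤ 1
    rw [map_mul, map_inv₀, hval1 s hs, inv_one, mul_one]
    exact Polynomial.valuation_le_one_of_valuation_X_le_one _ hle a

/-- **Stichtenoth Theorem 1.2.2** for `PlaceOver`: every place of `K(X)/K` is `P_∞` or some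
`P_{p(x)}` (`PlaceOver.ofPrime`). [cite: Stichtenoth2009, Thm. 1.2.2] -/
theorem eq_ratFuncInftyPlace_or_exists_eq_ofPrime (w : PlaceOver K (RatFunc K)) :
    w = ratFuncInftyPlace K ∨
      ∃ q : HeightOneSpectrum K[X], w = PlaceOver.ofPrime K (RatFunc K) q := by
  classical
  rcases eq_inftyValuationSubring_or_exists_eq_adicValuationSubring w.toValuationSubring
      w.ne_top w.algebraMap_mem with h | ⟨q, h⟩
  · exact Or.inl (PlaceOver.ext (h.trans ratFuncInftyPlace_toValuationSubring.symm))
  · exact Or.inr ⟨q, PlaceOver.ext h⟩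

variable (K) in
/-- **The places of `K(X)/K`** (Stichtenoth Thm. 1.2.2 with Prop. 1.2.1): `P_∞` together with the
`P_p`, `p` ranging over the nonzero primes of `K[X]` (equivalently the monic irreducible
polynomials), are all the places of `K(X)/K`, without repetition.
[cite: Stichtenoth2009, Thm. 1.2.2] -/
def ratFuncPlaceEquiv : Option (HeightOneSpectrum K[X]) ≃ PlaceOver K (RatFunc K) :=
  Equiv.ofBijective (fun o ↦ o.elim (ratFuncInftyPlace K) (PlaceOver.ofPrime K (RatFunc K))) (by
    constructor
    · rintro (_ | q₁) (_ | q₂) h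
      · rfl
      · exact absurd h (ofPrime_ne_ratFuncInftyPlace q₂).symm
      · exact absurd h (ofPrime_ne_ratFuncInftyPlace q₁)
      · exact congrArg some (PlaceOver.ofPrime_injective h)
    · intro w
      rcases eq_ratFuncInftyPlace_or_exists_eq_ofPrime w with rfl | ⟨q, rfl⟩
      · exact ⟨none, rfl⟩
      · exact ⟨some q, rfl⟩)

/-- `ratFuncPlaceEquiv` sends `none` to `P_∞` (definitional unfolding). [folklore] -/
@[simp]
theorem ratFuncPlaceEquiv_none : ratFuncPlaceEquiv K none = ratFuncInftyPlace K := rfl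

/-- `ratFuncPlaceEquiv` sends `some p` to `P_p` (definitional unfolding). [folklore] -/
@[simp]
theorem ratFuncPlaceEquiv_some (q : HeightOneSpectrum K[X]) :
    ratFuncPlaceEquiv K (some q) = PlaceOver.ofPrime K (RatFunc K) q := rfl

/-! ### Prime elements and the Riemann–Roch condition at the places of `K(X)` -/

/-- **Stichtenoth Prop. 1.2.1 (c)** (prime element): `1/x` is a prime element of `P_∞`
(`v_∞(1/x) = exp (-1)` and the chosen uniformizer of `P_∞` has the same valuation); hence the
condition `v_P(z) ≤ v_P(π_P) ^ (-n)` defining `L(D)` at `P_∞` reads `v_∞(z) ≤ exp n`, i.e.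
`deg z ≤ n`. [cite: Stichtenoth2009, Prop. 1.2.1(c)] -/
theorem valuation_ratFuncInftyPlace_le_iff [DecidableEq (RatFunc K)] (z : RatFunc K) (n : ℤ) :
    (ratFuncInftyPlace K).valuation z ≤
        (ratFuncInftyPlace K).valuation ((ratFuncInftyPlace K).uniformizer : RatFunc K) ^ (-n) ↔
      RatFunc.inftyValuation K z ≤ exp n :=
  (ratFuncInftyPlace K).valuation_le_iff_of_isEquiv
    isEquiv_valuation_ratFuncInftyPlace_inftyValuation.symm
    ⟨1 / RatFunc.X, RatFunc.inftyValuation.X_inv K⟩ z n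

/-! ### Degrees of the places of `K(X)` (Stichtenoth Prop. 1.2.1) -/

/-- **Stichtenoth Prop. 1.2.1 (a)** (residue field): the residue class field of `P_p` is
`K[X]/(p)` (localisation preserves residue fields, Mathlib
`IsLocalization.AtPrime.equivQuotMaximalIdeal`), so `deg P_p = dim_K K[X]/(p) = deg p(X)`.
[cite: Stichtenoth2009, Prop. 1.2.1(a)] -/
theorem degree_ofPrime_eq_finrank_quotient (q : HeightOneSpectrum K[X]) :
    (PlaceOver.ofPrime K (RatFunc K) q).degree = Module.finrank K (K[X] ⧸ q.asIdeal) := by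
  -- notation
  let w := PlaceOver.ofPrime K (RatFunc K) q
  let O := w.toValuationSubring
  have hO : ∀ x, x ∈ O ↔ q.valuation (RatFunc K) x ≤ 1 := PlaceOver.mem_ofPrime_iff q
  have hpoly : ∀ p : K[X], algebraMap K[X] (RatFunc K) p ∈ O := fun p ↦
    (hO _).2 (HeightOneSpectrum.valuation_le_one q p)
  -- the residue class map `K[X] → O_p → O_p / P_p`
  let φ : K[X] →+* O := (algebraMap K[X] (RatFunc K)).codRestrict O hpoly
  let ψ : K[X] →+* w.residueField := (IsLocalRing.residue O).comp φ
  have hφ : ∀ p, (φ p : RatFunc K) = algebraMap K[X] (RatFunc K) p := fun p ↦ rfl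
  -- its kernel is `p`
  have hker : ∀ p : K[X], ψ p = 0 ↔ p ∈ q.asIdeal := fun p ↦ by
    change IsLocalRing.residue O (φ p) = 0 ↔ _
    rw [IsLocalRing.residue_eq_zero_iff, w.mem_maximalIdeal_iff_of_mem_iff hO, hφ,
      HeightOneSpectrum.valuation_lt_one_iff_mem]
  -- it is surjective (Stichtenoth: `u/v = (a u / v) p + b u ≡ b u` if `a p + b v = 1`)
  have hsurj : Function.Surjective ψ := by
    intro y
    obtain ⟨x, rfl⟩ := IsLocalRing.residue_surjective y
    obtain ⟨a, ⟨s, hs⟩, hxs⟩ := q.exists_primeCompl_mul_eq_of_integer (x : RatFunc K) ((hO x).1 x.2)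
    letI : Field (K[X] ⧸ q.asIdeal) := Ideal.Quotient.field q.asIdeal
    have hs' : Ideal.Quotient.mk q.asIdeal s ≠ 0 := by
      rwa [Ne, Ideal.Quotient.eq_zero_iff_mem]
    obtain ⟨t, ht⟩ := Ideal.Quotient.mk_surjective (Ideal.Quotient.mk q.asIdeal s)⁻¹
    have hst : s * t - 1 ∈ q.asIdeal := by
      rw [← Ideal.Quotient.eq_zero_iff_mem, map_sub, map_mul, ht, mul_inv_cancel₀ hs', map_one,
        sub_self]
    refine ⟨a * t, ?_⟩
    change IsLocalRing.residue O (φ (a * t)) = IsLocalRing.residue O x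
    rw [eq_comm, ← sub_eq_zero, ← map_sub, IsLocalRing.residue_eq_zero_iff,
      w.mem_maximalIdeal_iff_of_mem_iff hO]
    have hvs : q.valuation (RatFunc K) (algebraMap K[X] (RatFunc K) s) = 1 :=
      (HeightOneSpectrum.valuation_eq_one_iff_notMem q).2 hs
    have hs0 : algebraMap K[X] (RatFunc K) s ≠ 0 := by
      intro h; rw [h, map_zero] at hvs; exact zero_ne_one hvs
    have hx : (x : RatFunc K) =
        algebraMap K[X] (RatFunc K) a * (algebraMap K[X] (RatFunc K) s)⁻¹ :=
      (eq_mul_inv_iff_mul_eq₀ hs0).2 hxs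
    have key : ((x - φ (a * t) : O) : RatFunc K) =
        algebraMap K[X] (RatFunc K) a * (algebraMap K[X] (RatFunc K) s)⁻¹ *
          algebraMap K[X] (RatFunc K) (-(s * t - 1)) := by
      change (x : RatFunc K) - (φ (a * t) : RatFunc K) = _
      rw [hφ, hx, map_neg, map_sub, map_mul, map_one, map_mul]
      set A := algebraMap K[X] (RatFunc K) a
      set S := algebraMap K[X] (RatFunc K) s
      set T := algebraMap K[X] (RatFunc K) t
      calc A * S⁻¹ - A * T = A * S⁻¹ - A * T * (S⁻¹ * S) := by
            rw [inv_mul_cancel₀ hs0, mul_one]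
        _ = A * S⁻¹ * -(S * T - 1) := by ring
    have hlt1 : q.valuation (RatFunc K) (algebraMap K[X] (RatFunc K) (s * t - 1)) < 1 :=
      (HeightOneSpectrum.valuation_lt_one_iff_mem q (s * t - 1)).2 hst
    change q.valuation (RatFunc K) ((x - φ (a * t) : O) : RatFunc K) < 1
    rw [key, Valuation.map_mul, Valuation.map_mul, map_inv₀, hvs, inv_one, mul_one, map_neg,
      Valuation.map_neg]
    rw [mul_comm]
    exact mul_lt_one_of_lt_of_le hlt1 (HeightOneSpectrum.valuation_le_one q a)
  -- hence `K[X]/p ≃ O_p/P_p`, `K`-linearly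
  have hkereq : RingHom.ker ψ = q.asIdeal := by
    ext p; rw [RingHom.mem_ker, hker]
  let e : (K[X] ⧸ q.asIdeal) ≃+* w.residueField :=
    (Ideal.quotEquivOfEq hkereq.symm).trans (RingHom.quotientKerEquivOfSurjective hsurj)
  have he : ∀ c : K, e (algebraMap K (K[X] ⧸ q.asIdeal) c) = algebraMap K w.residueField c := by
    intro c
    rw [← Ideal.Quotient.mk_algebraMap, Polynomial.algebraMap_apply, RingEquiv.trans_apply,
      Ideal.quotEquivOfEq_mk, RingHom.quotientKerEquivOfSurjective_apply_mk,
      PlaceOver.algebraMap_residueField_apply]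
    change IsLocalRing.residue O (φ (C c)) = IsLocalRing.residue O (algebraMap K O c)
    refine congrArg _ (Subtype.ext ?_)
    rw [hφ, PlaceOver.algebraMap_toValuationSubring_apply, RatFunc.algebraMap_C,
      RatFunc.algebraMap_eq_C]
  let e' : (K[X] ⧸ q.asIdeal) ≃ₐ[K] w.residueField := AlgEquiv.ofRingEquiv (f := e) he
  exact e'.toLinearEquiv.finrank_eq.symm

/-- `deg P_p = deg p(X)` for the monic (or any) generator `p(X)` of `p`.
[cite: Stichtenoth2009, Prop. 1.2.1(a)] -/
theorem degree_ofPrime_eq_natDegree (q : HeightOneSpectrum K[X]) {p : K[X]}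
    (hp : q.asIdeal = Ideal.span {p}) :
    (PlaceOver.ofPrime K (RatFunc K) q).degree = p.natDegree := by
  rw [degree_ofPrime_eq_finrank_quotient, hp, finrank_quotient_span_eq_natDegree]

/-- **Stichtenoth Prop. 1.2.1 (c)** (residue field): the residue class map of `P_∞` is
`z ↦ z(∞)`, onto `K`; hence `deg P_∞ = 1`. [cite: Stichtenoth2009, Prop. 1.2.1(c)] -/
theorem degree_ratFuncInftyPlace : (ratFuncInftyPlace K).degree = 1 := by
  classical
  set w := ratFuncInftyPlace K with hw
  have hO : ∀ x, x ∈ w.toValuationSubring ↔ RatFunc.inftyValuation K x ≤ 1 :=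
    mem_ratFuncInftyPlace_iff
  -- every element of `O_∞` is congruent to a constant modulo `P_∞`
  have hsurj : Function.Surjective (algebraMap K w.residueField) := by
    intro y
    obtain ⟨x, rfl⟩ := IsLocalRing.residue_surjective y
    -- x = num / denom with deg num ≤ deg denom
    have hx : RatFunc.inftyValuation K x ≤ 1 := (hO x).1 x.2
    suffices h :
        ∃ c : K, RatFunc.inftyValuation K ((x : RatFunc K) - algebraMap K (RatFunc K) c) < 1 by
      obtain ⟨c, hc⟩ := h
      refine ⟨c, ?_⟩
      rw [PlaceOver.algebraMap_residueField_apply, eq_comm, ← sub_eq_zero, ← map_sub,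
        IsLocalRing.residue_eq_zero_iff, w.mem_maximalIdeal_iff_of_mem_iff hO]
      exact hc
    set f : RatFunc K := (x : RatFunc K) with hf
    by_cases hf0 : f = 0
    · exact ⟨0, by simp [hf0]⟩
    have hnum : f.num ≠ 0 := RatFunc.num_ne_zero hf0
    have hden : f.denom ≠ 0 := RatFunc.denom_ne_zero f
    have hdeg : (f.num.natDegree : ℤ) ≤ f.denom.natDegree := by
      have := hx
      rw [RatFunc.inftyValuation_apply, RatFunc.inftyValuation_of_nonzero _ hf0, ← exp_zero,
        exp_le_exp, RatFunc.intDegree] at this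
      linarith
    rcases hdeg.lt_or_eq with hlt | heq
    · refine ⟨0, ?_⟩
      rw [map_zero, sub_zero, RatFunc.inftyValuation_apply, RatFunc.inftyValuation_of_nonzero _ hf0,
        ← exp_zero, exp_lt_exp, RatFunc.intDegree]
      linarith
    · -- deg num = deg denom: subtract the ratio of leading coefficients
      refine ⟨f.num.leadingCoeff, ?_⟩
      set g : K[X] := f.num - Polynomial.C f.num.leadingCoeff * f.denom with hg
      have hfg : f - algebraMap K (RatFunc K) f.num.leadingCoeff =
          algebraMap K[X] (RatFunc K) g / algebraMap K[X] (RatFunc K) f.denom := by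
        have hden' : algebraMap K[X] (RatFunc K) f.denom ≠ 0 := by simpa using hden
        have hf' := RatFunc.num_div_denom f
        rw [div_eq_iff hden'] at hf'
        rw [eq_div_iff hden', hg, map_sub, map_mul, sub_mul, RatFunc.algebraMap_C,
          ← RatFunc.algebraMap_eq_C, hf']
      rw [hfg]
      by_cases hg0 : g = 0
      · simp [hg0]
      have hgdeg : g.natDegree < f.denom.natDegree := by
        have hmonic := RatFunc.monic_denom f
        have h1 : g.degree < f.num.degree := by
          rw [hg]
          apply Polynomial.degree_sub_lt
          · rw [Polynomial.degree_mul,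
              Polynomial.degree_C (Polynomial.leadingCoeff_ne_zero.2 hnum), zero_add,
              Polynomial.degree_eq_natDegree hnum, Polynomial.degree_eq_natDegree hden]
            exact_mod_cast heq
          · exact hnum
          · rw [Polynomial.leadingCoeff_mul, Polynomial.leadingCoeff_C, hmonic.leadingCoeff,
              mul_one]
        have h2 : g.natDegree < f.num.natDegree := Polynomial.natDegree_lt_natDegree hg0 h1
        omega
      rw [map_div₀, RatFunc.inftyValuation_apply, RatFunc.inftyValuation_apply,
        RatFunc.inftyValuation.polynomial _ hg0, RatFunc.inftyValuation.polynomial _ hden,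
        ← exp_sub, ← exp_zero, exp_lt_exp]
      omega
  have hinj : Function.Injective (algebraMap K w.residueField) := (algebraMap K _).injective
  let e := LinearEquiv.ofBijective (Algebra.linearMap K w.residueField) ⟨hinj, hsurj⟩
  rw [PlaceOver.degree, ← e.finrank_eq, Module.finrank_self]

/-- Degrees of the places of `K(X)` through `ratFuncPlaceEquiv`: `deg P_∞ = 1` and
`deg P_p = dim_K K[X]/(p)`. [cite: Stichtenoth2009, Prop. 1.2.1] -/
theorem degree_ratFuncPlaceEquiv (o : Option (HeightOneSpectrum K[X])) :
    (ratFuncPlaceEquiv K o).degree =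
      o.elim 1 fun q ↦ Module.finrank K (K[X] ⧸ q.asIdeal) := by
  cases o with
  | none => exact degree_ratFuncInftyPlace
  | some q => exact degree_ofPrime_eq_finrank_quotient q

end RatFunc

end Literature.NumberTheory.DiophantineGeometry.AlgFunctionField
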